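import Literature.NumberTheory.Automorphic.QuaternionEuclideanEmbedding
import Literature.NumberTheory.Automorphic.QuaternionLocalSplit
import Literature.NumberTheory.Automorphic.QuaternionLocalRamifiedDual
import Mathlib.LinearAlgebra.FreeModule.Finite.CardQuotient
import HarnessLib

/-!
# The discriminant of a maximal order: `[O₁♯ : O₁] = (N⁻)²`, hence `covol ψ O₁ = N⁻ / 4` and
# `covol ψ O = N⁺ N⁻ / 4` for an Eichler order of level `N⁺`
# (Vignéras, LNM 800, Ch. I §4 Lemme 4.7, Ch. II §1 Cor. 1.7, §2, Ch. III §5 Cor. 5.3)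

Topic `NumberTheory/Automorphic`; theorems only (no definition, no named fact, no instance).
For a definite quaternion algebra `B` over `ℚ` ramified exactly at the primes dividing the
squarefree `N⁻` (the ramification datum of an Eichler package) and a maximal `ℤ`-order `O₁`, the
dual lattice `O₁♯ = {x | trd(x ȳ) ∈ ℤ ∀ y ∈ O₁}` of `O₁` for the trace form `(x, y) ↦ trd(x ȳ)`
has index

  `[O₁♯ : O₁] = (N⁻)²`   (`relIndex_dual_eq_sq`):

the index is the product of its localisations (`relIndex_localAt`, `LatticeLocalGlobal.lean`),
which are `1` at a split prime (the local order `M₂(ℤ_p)` is self-dual,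
`forall_not_dvd_den_reducedTrace_iff_of_split`) and `p²` at a ramified prime (the dual is
`π⁻¹ O₁,₍ₚ₎`, `forall_not_dvd_den_reducedTrace_iff_of_ramified`) — Vignéras I §4 Lemme 4.7
(discriminant réduit, `d(O) = N(O♯⁻¹)`), II §1 Cor. 1.7 and §2 (local values), III §5 Cor. 5.3
("le discriminant réduit d'un ordre maximal est égal au produit des idéaux premiers ramifiés").
With the Gram-determinant formula `16 covol(ψ O₁)² = det (trd(bᵢ b̄ⱼ)) = [O₁♯ : O₁]`
(`QuaternionEuclideanEmbedding.lean`, Mathlib `AddSubgroup.relIndex_eq_abs_det`) this gives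
**`covol ψ O₁ = N⁻ / 4`** and, for an Eichler order `O` of level `N⁺` (`[O₁ : O] = N⁺`),
**`covol ψ O = N⁺ N⁻ / 4`** — the covolume normalisation in Eichler's mass formula
(`brandtModule_massFormula`).

## References

* M.-F. Vignéras, *Arithmétique des algèbres de quaternions*, LNM 800 (1980), Ch. I §4
  Lemme 4.7; Ch. II §1 Cor. 1.7, §2; Ch. III §5 Cor. 5.3 [VignerasLNM800].
* J. Voight, *Quaternion Algebras*, GTM 288 (2021), §15.2, Thm. 15.5.5, 23.4.
-/

noncomputable section

open scoped Pointwise TensorProduct InnerProductSpace RealInnerProductSpace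
open NumberField IsDedekindDomain Module

universe u

namespace Literature.NumberTheory.Automorphic

variable {B : Type u} [Ring B] [Algebra ℚ B] [IsQuaternionAlgebra ℚ B]

/-! ### The trace form `(x, y) ↦ trd(x ȳ)` and its dual lattices -/

section TraceForm

omit [IsQuaternionAlgebra ℚ B] in
/-- The standard involution as a `ℚ`-linear map. [folklore] -/
theorem exists_linearMap_standardInvolution :
    ∃ σ : B →ₗ[ℚ] B, ∀ x, σ x = standardInvolution ℚ B x :=
  ⟨{ toFun := standardInvolution ℚ B
     map_add' := standardInvolution_add ℚ
     map_smul' := fun c x => by rw [standardInvolution_smul ℚ, RingHom.id_apply] }, fun _ => rfl⟩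

omit [IsQuaternionAlgebra ℚ B] in
/-- The trace form `T(x, y) = trd(x ȳ)` as a bilinear form. [folklore] -/
theorem exists_bilinForm_trace_conj :
    ∃ T : LinearMap.BilinForm ℚ B, ∀ x y, T x y = reducedTrace ℚ B (x * standardInvolution ℚ B y) := by
  obtain ⟨σ, hσ⟩ := exists_linearMap_standardInvolution (B := B)
  exact ⟨((LinearMap.mul ℚ B).compl₂ σ).compr₂ (reducedTrace ℚ B), fun x y => by
    simp [LinearMap.compr₂_apply, LinearMap.compl₂_apply, hσ]⟩

/-- In a totally definite quaternion algebra the trace form `trd(x ȳ)` is nondegenerate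
(`trd(x x̄) = 2 nrd(x) > 0` for `x ≠ 0`). [cite: VignerasLNM800, Ch. I §1 Lemme 1.1] -/
theorem nondegenerate_trace_conj (hdef : IsTotallyDefinite ℚ B) (T : LinearMap.BilinForm ℚ B)
    (hT : ∀ x y, T x y = reducedTrace ℚ B (x * standardInvolution ℚ B y)) : T.Nondegenerate := by
  have key : ∀ x : B, T x x = 0 → x = 0 := by
    intro x hx
    rw [hT, reducedTrace_mul_standardInvolution_self ℚ] at hx
    by_contra hne
    have := reducedNorm_pos_of_isTotallyDefinite B hdef hne
    linarith
  refine ⟨fun x hx => key x (hx x), fun y hy => key y (hy y)⟩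

end TraceForm

/-! ### The Gram determinant is the index of the dual -/

section GramIndex

omit [IsQuaternionAlgebra ℚ B] in
/-- **`[L♯ : L] = det (trd(bᵢ b̄ⱼ))`** in absolute value, for a full lattice `L` integral for the
trace form (`trd(x ȳ) ∈ ℤ` on `L`), `L♯` its dual and `(bᵢ)` a `ℤ`-basis (Mathlib
`AddSubgroup.relIndex_eq_abs_det` with the dual basis, `BilinForm.dualSubmodule_span_of_basis`).
[cite: VignerasLNM800, Ch. I §4 Lemme 4.7] -/
theorem cast_relIndex_dualSubmodule_eq_abs_det (T : LinearMap.BilinForm ℚ B)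
    (hT : ∀ x y, T x y = reducedTrace ℚ B (x * standardInvolution ℚ B y)) (hTnd : T.Nondegenerate)
    {L : Submodule ℤ B} (hL : IsFullLattice B L) (bL : Module.Basis (Fin 4) ℤ L)
    (hint : ∀ x ∈ L, ∀ y ∈ L, ∃ n : ℤ, reducedTrace ℚ B (x * standardInvolution ℚ B y) = n) :
    ((L.toAddSubgroup.relIndex (T.dualSubmodule L).toAddSubgroup : ℕ) : ℚ) =
      |(Matrix.of fun i j => reducedTrace ℚ B ((bL i : B) * standardInvolution ℚ B (bL j : B))).det| := by
  classical
  haveI : IsAddTorsionFree B := isAddTorsionFree_of_charZero_module ℚ B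
  haveI : Module.Finite ℤ L := Module.Finite.iff_fg.mpr hL.1
  haveI : IsAddTorsionFree L := L.toAddSubgroup.instIsAddTorsionFree
  haveI := isLocalizedModule_subtype_of_isFullLattice hL
  let bQ : Module.Basis (Fin 4) ℚ B := bL.ofIsLocalizedModule ℚ (nonZeroDivisors ℤ) L.subtype
  have hbQ : ∀ k, bQ k = (bL k : B) := fun k => Module.Basis.ofIsLocalizedModule_apply _ _ _ _ k
  have hLspan : L = Submodule.span ℤ (Set.range bQ) := by
    rw [eq_span_range_basis bL]; congr 1; ext x; simp [hbQ]
  have hle : L ≤ T.dualSubmodule L := by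
    intro x hx
    rw [LinearMap.BilinForm.mem_dualSubmodule]
    intro y hy
    obtain ⟨n, hn⟩ := hint x hx y hy
    rw [hT, hn, Submodule.mem_one]
    exact ⟨n, by simp⟩
  have h1 : L.toAddSubgroup = AddSubgroup.closure (Set.range bQ) := by
    rw [hLspan, Submodule.span_int_eq_addSubgroupClosure]
  have h2 : (T.dualSubmodule L).toAddSubgroup = AddSubgroup.closure (Set.range (T.dualBasis hTnd bQ)) := by
    rw [hLspan, LinearMap.BilinForm.dualSubmodule_span_of_basis _ hTnd, Submodule.span_int_eq_addSubgroupClosure]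
  rw [AddSubgroup.relIndex_eq_abs_det L.toAddSubgroup (T.dualSubmodule L).toAddSubgroup
    (Submodule.toAddSubgroup_mono hle) bQ (T.dualBasis hTnd bQ) h1 h2, Module.Basis.det_apply]
  congr 1
  rw [← Matrix.det_transpose]
  congr 1
  ext i j
  rw [Matrix.transpose_apply, Module.Basis.toMatrix_apply, LinearMap.BilinForm.dualBasis_repr_apply, hT,
    Matrix.of_apply, hbQ, hbQ]

/-- **`16 covol(ψ L)² = [L♯ : L]`** for a full lattice integral for the trace form. [cite: VignerasLNM800, Ch. I §4 Lemme 4.7] -/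
theorem sixteen_mul_covol_sq_eq_relIndex_dual (ψ : B →ₗ[ℚ] EuclideanSpace ℝ (Fin 4))
    (hψs : Submodule.span ℝ (Set.range ψ) = ⊤) (hψn : ∀ x, ‖ψ x‖ ^ 2 = ((reducedNorm ℚ B x : ℚ) : ℝ))
    (T : LinearMap.BilinForm ℚ B) (hT : ∀ x y, T x y = reducedTrace ℚ B (x * standardInvolution ℚ B y))
    (hTnd : T.Nondegenerate) {L : Submodule ℤ B} (hL : IsFullLattice B L)
    (hint : ∀ x ∈ L, ∀ y ∈ L, ∃ n : ℤ, reducedTrace ℚ B (x * standardInvolution ℚ B y) = n) :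
    16 * covol ψ L ^ 2 = (L.toAddSubgroup.relIndex (T.dualSubmodule L).toAddSubgroup : ℝ) := by
  obtain ⟨bL⟩ := hL.nonempty_basis_fin_four
  have h16 := sixteen_mul_covol_sq ψ hψs hψn hL bL
  have hidx := cast_relIndex_dualSubmodule_eq_abs_det T hT hTnd hL bL hint
  set d : ℚ := (Matrix.of fun i j => reducedTrace ℚ B ((bL i : B) * standardInvolution ℚ B (bL j : B))).det
  have hdpos : 0 ≤ d := by
    have : (0 : ℝ) ≤ (d : ℝ) := by rw [← h16]; positivity
    exact_mod_cast this
  rw [abs_of_nonneg hdpos] at hidx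
  rw [h16, show ((L.toAddSubgroup.relIndex (T.dualSubmodule L).toAddSubgroup : ℕ) : ℝ) =
    (((L.toAddSubgroup.relIndex (T.dualSubmodule L).toAddSubgroup : ℕ) : ℚ) : ℝ) by norm_cast, hidx]

end GramIndex

/-! ### Localising the dual -/

section LocalDual

variable {p : ℕ} [hp : Fact p.Prime]

omit [IsQuaternionAlgebra ℚ B] in
/-- **The dual localises**: for a finitely generated lattice `L`,
`(L♯)₍ₚ₎ = {x | trd(x ȳ) ∈ ℤ₍ₚ₎ for all y ∈ L₍ₚ₎}`. [folklore] -/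
theorem mem_localAt_dualSubmodule_iff (T : LinearMap.BilinForm ℚ B)
    (hT : ∀ x y, T x y = reducedTrace ℚ B (x * standardInvolution ℚ B y)) {L : Submodule ℤ B} (hfg : L.FG) (x : B) :
    x ∈ localAt p (T.dualSubmodule L) ↔
      ∀ y ∈ localAt p L, ¬ p ∣ (reducedTrace ℚ B (x * standardInvolution ℚ B y)).den := by
  have hpp : p.Prime := hp.out
  constructor
  · rintro ⟨m, hm0, hm, hmx⟩ y ⟨n, hn0, hn, hny⟩
    rw [LinearMap.BilinForm.mem_dualSubmodule] at hmx
    obtain ⟨z, hz⟩ := Submodule.mem_one.mp (hmx _ hny)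
    rw [hT] at hz
    -- `trd((m x) (n y)‾) = m n trd(x ȳ) = z`
    have hmn : ((m * n : ℕ) : ℚ) * reducedTrace ℚ B (x * standardInvolution ℚ B y) = (z : ℚ) := by
      rw [← eq_intCast (algebraMap ℤ ℚ) z, hz, natCast_zsmul_eq_ratCast_smul, natCast_zsmul_eq_ratCast_smul,
        standardInvolution_smul ℚ, smul_mul_assoc, mul_smul_comm, map_smul, map_smul, smul_eq_mul, smul_eq_mul]
      push_cast; ring
    have hcop : (m * n).Coprime p := hm.mul_left hn
    intro hdvd
    have h1 : ¬ p ∣ ((((m * n : ℕ) : ℚ) * reducedTrace ℚ B (x * standardInvolution ℚ B y))).den := by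
      rw [hmn]; exact not_dvd_den_intCast hpp z
    apply h1
    -- denominator of `(mn) q` for `q` with `p ∣ den q` and `p ∤ mn`
    set q := reducedTrace ℚ B (x * standardInvolution ℚ B y) with hq
    have hv : padicValRat p (((m * n : ℕ) : ℚ) * q) < 0 := by
      have hq0 : q ≠ 0 := by rintro h0; rw [h0, Rat.den_zero] at hdvd; exact hpp.one_lt.ne' (Nat.dvd_one.mp hdvd)
      rw [padicValRat.mul (by exact_mod_cast (mul_ne_zero hm0 hn0)) hq0, padicValRat_natCast_eq_zero_of_coprime hcop,
        zero_add]
      by_contra hge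
      push Not at hge
      exact not_dvd_den_of_padicValRat_nonneg hge hdvd
    by_contra hnd
    exact absurd (padicValRat_nonneg_of_not_dvd_den hnd) (not_le.mpr hv)
  · intro h
    obtain ⟨t, ht⟩ := hfg
    -- clear the prime-to-`p` denominators over the generators
    set m : ℕ := ∏ y ∈ t, (reducedTrace ℚ B (x * standardInvolution ℚ B y)).den with hm
    have hm0 : m ≠ 0 := Finset.prod_ne_zero_iff.mpr fun y _ => Rat.den_ne_zero _
    have hmcop : m.Coprime p := Nat.Coprime.prod_left fun y hy =>
      ((Nat.Prime.coprime_iff_not_dvd hpp).mpr (h y (le_localAt p L (ht ▸ Submodule.subset_span hy)))).symm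
    refine mem_localAt_of_smul_mem hm0 hmcop ?_
    rw [LinearMap.BilinForm.mem_dualSubmodule]
    intro y hy
    rw [← ht] at hy
    induction hy using Submodule.span_induction with
    | mem y hy =>
      rw [hT, natCast_zsmul_eq_ratCast_smul, smul_mul_assoc, map_smul, smul_eq_mul, Submodule.mem_one]
      obtain ⟨z, hz⟩ := Rat.exists_int_natCast_mul_of_den_dvd (reducedTrace ℚ B (x * standardInvolution ℚ B y))
        (Finset.dvd_prod_of_mem (fun y => (reducedTrace ℚ B (x * standardInvolution ℚ B y)).den) hy)
      exact ⟨z, by rw [eq_intCast, hz]⟩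
    | zero => rw [LinearMap.map_zero]; exact Submodule.zero_mem _
    | add a b _ _ ha hb => rw [LinearMap.map_add]; exact Submodule.add_mem _ ha hb
    | smul k a _ ha => rw [LinearMap.map_smul_of_tower]; exact Submodule.smul_mem _ k ha

omit hp in
/-- For an order, the local dual conditions for `trd(x ȳ)` and `trd(x y)` agree
(`O₍ₚ₎` is stable under the standard involution). [folklore] -/
theorem forall_conj_iff_forall {O : Submodule ℤ B} (hO : IsZOrder O) (x : B) :
    (∀ y ∈ localAt p O, ¬ p ∣ (reducedTrace ℚ B (x * standardInvolution ℚ B y)).den) ↔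
      ∀ y ∈ localAt p O, ¬ p ∣ (reducedTrace ℚ B (x * y)).den := by
  constructor
  · intro h y hy
    have := h _ (hO.standardInvolution_mem_localAt hy)
    rwa [standardInvolution_standardInvolution] at this
  · intro h y hy
    exact h _ (hO.standardInvolution_mem_localAt hy)

end LocalDual

/-! ### `[O₁♯ : O₁] = (N⁻)²` -/

section Discriminant

/-- **The discriminant of a maximal order is `(N⁻)²`**: for a definite quaternion algebra `B`
over `ℚ` ramified exactly at the primes dividing the squarefree `N⁻` and a maximal `ℤ`-order
`O₁`, the dual of `O₁` for the trace form `trd(x ȳ)` has index `(N⁻)²` (Vignéras III §5 Cor. 5.3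
with II §1 Cor. 1.7, §2: locally the index is `p²` at a ramified prime and `1` at a split one).
[cite: VignerasLNM800, Ch. III §5 Cor. 5.3, Ch. II §1 Cor. 1.7 and §2, Ch. I §4 Lemme 4.7] -/
theorem relIndex_dual_eq_sq (hdef : IsTotallyDefinite ℚ B) {Nminus : ℕ} (hsq : Squarefree Nminus)
    (hram : ∀ v : HeightOneSpectrum (𝓞 ℚ), v ∈ ramifiedPlaces ℚ B ↔ ((Nminus : ℕ) : 𝓞 ℚ) ∈ v.asIdeal)
    (T : LinearMap.BilinForm ℚ B) (hT : ∀ x y, T x y = reducedTrace ℚ B (x * standardInvolution ℚ B y))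
    {O₁ : Submodule ℤ B} (hO₁ : IsMaximalZOrder O₁)
    (ψ : B →ₗ[ℚ] EuclideanSpace ℝ (Fin 4)) (hψs : Submodule.span ℝ (Set.range ψ) = ⊤)
    (hψn : ∀ x, ‖ψ x‖ ^ 2 = ((reducedNorm ℚ B x : ℚ) : ℝ)) :
    O₁.toAddSubgroup.relIndex (T.dualSubmodule O₁).toAddSubgroup = Nminus ^ 2 := by
  classical
  have hdiv : ∀ x : B, x ≠ 0 → IsUnit x := fun x hx => isUnit_of_isTotallyDefinite B hdef hx
  have hTnd := nondegenerate_trace_conj hdef T hT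
  have hN0 : Nminus ≠ 0 := hsq.ne_zero
  -- integrality of the trace form on `O₁`
  have hint : ∀ x ∈ O₁, ∀ y ∈ O₁, ∃ n : ℤ, reducedTrace ℚ B (x * standardInvolution ℚ B y) = n := by
    intro x hx y hy
    obtain ⟨t, -, ht, -⟩ := hO₁.1.toIsOrder.exists_int_reducedTrace_reducedNorm
      (hO₁.1.mul_mem _ hx _ (hO₁.1.toIsOrder.standardInvolution_mem hy))
    exact ⟨t, ht⟩
  have hle : O₁ ≤ T.dualSubmodule O₁ := by
    intro x hx
    rw [LinearMap.BilinForm.mem_dualSubmodule]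
    intro y hy
    obtain ⟨n, hn⟩ := hint x hx y hy
    rw [hT, hn, Submodule.mem_one]
    exact ⟨n, by simp⟩
  set n : ℕ := O₁.toAddSubgroup.relIndex (T.dualSubmodule O₁).toAddSubgroup with hn
  -- `n ≠ 0` from `16 covol² = n`
  have hn0 : n ≠ 0 := by
    intro h0
    have h := sixteen_mul_covol_sq_eq_relIndex_dual ψ hψs hψn T hT hTnd hO₁.1.isFullLattice hint
    rw [← hn, h0, Nat.cast_zero] at h
    have := covol_pos ψ hψs hO₁.1.isFullLattice (L := O₁)
    nlinarith
  -- the local indices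
  have hloc : ∀ p : ℕ, p.Prime → n.factorization p = (Nminus ^ 2).factorization p := by
    intro p hpp
    haveI : Fact p.Prime := ⟨hpp⟩
    have hrel := relIndex_localAt (T.dualSubmodule O₁) O₁ hle (p := p) hn0
    rw [← hn] at hrel
    -- the local dual
    have hdual : ∀ x, x ∈ localAt p (T.dualSubmodule O₁) ↔ ∀ y ∈ localAt p O₁, ¬ p ∣ (reducedTrace ℚ B (x * y)).den :=
      fun x => (mem_localAt_dualSubmodule_iff T hT hO₁.1.isFullLattice.1 x).trans (forall_conj_iff_forall hO₁.1 x)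
    rw [Nat.factorization_pow, Finsupp.smul_apply, smul_eq_mul]
    by_cases hpN : p ∣ Nminus
    · -- ramified: the dual is `π⁻¹ O₁,₍ₚ₎`, index `p²`
      have hTdiv := isUnit_padicTensor_of_dvd B hram hpN
      have hΛ : ∀ x : B, x ∈ localAt p O₁ ↔ ¬ p ∣ (reducedNorm ℚ B x).den :=
        fun x => hO₁.mem_localAt_iff_of_ramified hdiv hTdiv x
      obtain ⟨π, -, hπ⟩ := exists_uniformizer_of_ramified hdiv hO₁.1 hΛ
      have heq : localAt p (T.dualSubmodule O₁) = π⁻¹ • localAt p O₁ := by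
        ext x
        rw [hdual, forall_not_dvd_den_reducedTrace_iff_of_ramified hdiv hO₁.1 hΛ hTdiv π hπ x]
      rw [heq, relIndex_localAt_inv_uniformizer_smul hO₁.1 hΛ π hπ] at hrel
      have h2 : Nminus.factorization p = 1 := by
        have h1 := hsq.natFactorization_le_one p
        have h3 := (Nat.Prime.dvd_iff_one_le_factorization hpp hN0).mp hpN
        omega
      rw [h2, mul_one]
      exact (Nat.pow_right_injective hpp.two_le hrel).symm
    · -- split: the dual is `O₁,₍ₚ₎`, index `1`
      obtain ⟨φ⟩ := exists_algHom_matrix_of_not_dvd hram hpN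
      obtain ⟨u, hu⟩ := hO₁.exists_conjUnit_localAt_iff hdiv φ
      have heq : localAt p (T.dualSubmodule O₁) = localAt p O₁ := by
        ext x
        rw [hdual, forall_not_dvd_den_reducedTrace_iff_of_split (AlgHom.conjUnit φ u) hO₁.1 hu x]
      rw [heq, AddSubgroup.relIndex_self] at hrel
      have h2 : Nminus.factorization p = 0 := Nat.factorization_eq_zero_of_not_dvd hpN
      rw [h2, mul_zero]
      have : p ^ 0 = p ^ n.factorization p := by rw [pow_zero]; exact hrel
      exact (Nat.pow_right_injective hpp.two_le this).symm
  refine Nat.eq_of_factorization_eq hn0 (pow_ne_zero 2 hN0) fun p => ?_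
  by_cases hpp : p.Prime
  · exact hloc p hpp
  · rw [Nat.factorization_eq_zero_of_not_prime _ hpp, Nat.factorization_eq_zero_of_not_prime _ hpp]

/-- **`covol ψ O₁ = N⁻ / 4` for a maximal order** (from `16 covol² = [O₁♯ : O₁] = (N⁻)²`). [cite: VignerasLNM800, Ch. III §5 Cor. 5.3] -/
theorem covol_maximal_eq (hdef : IsTotallyDefinite ℚ B) {Nminus : ℕ} (hsq : Squarefree Nminus)
    (hram : ∀ v : HeightOneSpectrum (𝓞 ℚ), v ∈ ramifiedPlaces ℚ B ↔ ((Nminus : ℕ) : 𝓞 ℚ) ∈ v.asIdeal)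
    {O₁ : Submodule ℤ B} (hO₁ : IsMaximalZOrder O₁)
    (ψ : B →ₗ[ℚ] EuclideanSpace ℝ (Fin 4)) (hψs : Submodule.span ℝ (Set.range ψ) = ⊤)
    (hψn : ∀ x, ‖ψ x‖ ^ 2 = ((reducedNorm ℚ B x : ℚ) : ℝ)) :
    covol ψ O₁ = (Nminus : ℝ) / 4 := by
  obtain ⟨T, hT⟩ := exists_bilinForm_trace_conj (B := B)
  have hdiv : ∀ x : B, x ≠ 0 → IsUnit x := fun x hx => isUnit_of_isTotallyDefinite B hdef hx
  have hTnd := nondegenerate_trace_conj hdef T hT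
  have hint : ∀ x ∈ O₁, ∀ y ∈ O₁, ∃ n : ℤ, reducedTrace ℚ B (x * standardInvolution ℚ B y) = n := by
    intro x hx y hy
    obtain ⟨t, -, ht, -⟩ := hO₁.1.toIsOrder.exists_int_reducedTrace_reducedNorm
      (hO₁.1.mul_mem _ hx _ (hO₁.1.toIsOrder.standardInvolution_mem hy))
    exact ⟨t, ht⟩
  have h16 := sixteen_mul_covol_sq_eq_relIndex_dual ψ hψs hψn T hT hTnd hO₁.1.isFullLattice hint
  rw [relIndex_dual_eq_sq hdef hsq hram T hT hO₁ ψ hψs hψn] at h16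
  push_cast at h16
  have hpos := covol_pos ψ hψs hO₁.1.isFullLattice (L := O₁)
  have hfac : (4 * covol ψ O₁ - Nminus) * (4 * covol ψ O₁ + Nminus) = 0 := by linear_combination h16
  have hN : (0 : ℝ) ≤ Nminus := Nat.cast_nonneg _
  rcases mul_eq_zero.mp hfac with h | h
  · linarith
  · linarith

/-- **`covol ψ O = N⁺ N⁻ / 4` for an Eichler order of level `N⁺`** (`[O₁ : O] = N⁺` and
`covol ψ O = [O₁ : O] covol ψ O₁`). [cite: VignerasLNM800, Ch. III §5 Cor. 5.3 and Déf. (niveau)] -/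
theorem covol_eichler_eq (hdef : IsTotallyDefinite ℚ B) {Nplus Nminus : ℕ} (hsq : Squarefree Nminus)
    (hram : ∀ v : HeightOneSpectrum (𝓞 ℚ), v ∈ ramifiedPlaces ℚ B ↔ ((Nminus : ℕ) : 𝓞 ℚ) ∈ v.asIdeal)
    {O : Submodule ℤ B} (hO : IsEichlerOrder O Nplus)
    (ψ : B →ₗ[ℚ] EuclideanSpace ℝ (Fin 4)) (hψs : Submodule.span ℝ (Set.range ψ) = ⊤)
    (hψn : ∀ x, ‖ψ x‖ ^ 2 = ((reducedNorm ℚ B x : ℚ) : ℝ)) :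
    covol ψ O = (Nplus : ℝ) * Nminus / 4 := by
  have hZ : IsZOrder O := hO.isZOrder
  obtain ⟨O₁, O₂, hO₁, hO₂, hO12, hidx⟩ := hO
  have hψi : Function.Injective ψ := injective_euclideanEmbedding ψ hψn hdef
  have hle : O ≤ O₁ := by rw [hO12]; exact inf_le_left
  rw [covol_eq_relIndex_mul ψ hψs hψi hO₁.1.isFullLattice hZ.isFullLattice hle, hidx,
    covol_maximal_eq hdef hsq hram hO₁ ψ hψs hψn]
  ring

end Discriminant

end Literature.NumberTheory.Automorphic
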